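import Mathlib
import Literature.Analysis.FluidPDE.NSCriticalClosureHolds
import Literature.Analysis.FluidPDE.NSCriticalClosureBesovHolds
import Literature.Analysis.FluidPDE.KNSSTypeIIHolds
import Summits.NavierStokesRegularity.NavierStokesRegularity.Theorems.PlaneEnergyCeilingPlanarEnergyAPrioriClosedSlab

/-!
# Route PlaneEnergyCeiling · crux `PlanarEnergyAPriori` — the critical corners (`L³`, `L^∞`)

Helper file for the crux item stmt-NavierStokesRegularity-16855 (`PlanarEnergyAPriori`, route
`PlaneEnergyCeiling`), landed `--supports` that item: the crux HOLDS in the two classical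
continuation classes that the tree has DISCHARGED —

* `planarCeiling_of_eLpNorm_three_bounded` — the Escauriaza–Seregin–Šverák / Seregin class:
  along every classical solution of unforced Navier–Stokes on `ℝ³ × [0,T)` that is Leray–Hopf from
  a rapidly decaying datum with `sup_{t<T} ‖u(t)‖_{L³} < ∞`, the planar kinetic energies are bounded
  uniformly in `t < T`, the direction and the offset (discharged
  `hasSmoothExtensionPast_of_eLpNorm_three_bounded_holds`, Seregin 2012 Thm. 1.1 / ESS 2003);
* `planarCeiling_of_velocity_bounded` — the Leray class: the same for solutions bounded on
  `[0,T) × ℝ³` (discharged `hasSmoothExtensionPast_of_bounded_holds`, RRS 2016 Thm. 8.17),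

both through the landed `planarCeiling_of_hasSmoothExtensionPast` (seat 1, `…ClosedSlab.lean`).
So a counterexample to the crux must leave `L^∞_t L³_x` — the planar ceiling is at least as hard to
violate as the critical `L³` norm is to blow up (calibration of the crux against ns.S08).
Folklore assembly of accepted facts.
-/

noncomputable section

-- single-conjunct summit: `Summit.<Summit>.<Problem>` repeats the name by the D-0017 layout
set_option linter.dupNamespace false

namespace Summit.NavierStokesRegularity.NavierStokesRegularity.Theorems.PlanarEnergyAPriori

open MeasureTheory Set Filter Topology Function WithLp
open scoped ENNReal NNReal
open Literature.Analysis.FluidPDE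

variable {ν T : ℝ} {u : ℝ → EuclideanSpace ℝ (Fin 3) → EuclideanSpace ℝ (Fin 3)} {p : ℝ → EuclideanSpace ℝ (Fin 3) → ℝ}

/-- **THE CRUX IN THE `L^∞_t L³_x` (ESS) CLASS.** Along every classical solution of unforced
Navier–Stokes on `ℝ³ × [0,T)` (`ν, T > 0`) that is Leray–Hopf from a rapidly decaying datum and
has `sup_{t<T} ‖u(t)‖_{L³} < ∞`, the planar kinetic energies `∫_{R{x₂=c}} |u(t)|² dA` are bounded
uniformly in `t < T`, `R`, `c` (Seregin 2012 / ESS 2003, discharged in the tree). [folklore] -/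
theorem planarCeiling_of_eLpNorm_three_bounded (hν : 0 < ν) (hT : 0 < T)
    (hcl : IsClassicalNSSolutionOn (Ico 0 T) ν 0 u p) (hLH : IsLerayHopfOn T ν 0 (u 0) u)
    (hdec : HasRapidSpatialDecay (u 0)) (hL3 : (⨆ t ∈ Ico 0 T, eLpNorm (u t) 3 volume) < ⊤) :
    ∃ M : ℝ, ∀ t ∈ Ico 0 T, ∀ (R : EuclideanSpace ℝ (Fin 3) ≃ₗᵢ[ℝ] EuclideanSpace ℝ (Fin 3)) (c : ℝ),
      ∫⁻ y : EuclideanSpace ℝ (Fin 2), ‖u t (R (toLp 2 ![y 0, y 1, c]))‖ₑ ^ 2 ≤ ENNReal.ofReal M :=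
  planarCeiling_of_hasSmoothExtensionPast hν hT hcl hLH hdec
    (hasSmoothExtensionPast_of_eLpNorm_three_bounded_holds ν T hν hT u p hcl hLH hdec hL3)

/-- **THE CRUX FOR BOUNDED SOLUTIONS.** Along every classical solution of unforced Navier–Stokes
on `ℝ³ × [0,T)` (`ν, T > 0`) that is Leray–Hopf from a rapidly decaying datum and bounded on
`[0,T) × ℝ³`, the planar kinetic energies are bounded uniformly in `t < T`, `R`, `c`
(RRS 2016 Thm. 8.17, discharged in the tree). [folklore] -/
theorem planarCeiling_of_velocity_bounded (hν : 0 < ν) (hT : 0 < T)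
    (hcl : IsClassicalNSSolutionOn (Ico 0 T) ν 0 u p) (hLH : IsLerayHopfOn T ν 0 (u 0) u)
    (hdec : HasRapidSpatialDecay (u 0)) (hbdd : ∃ M : ℝ, ∀ t ∈ Ico 0 T, ∀ x, ‖u t x‖ ≤ M) :
    ∃ M : ℝ, ∀ t ∈ Ico 0 T, ∀ (R : EuclideanSpace ℝ (Fin 3) ≃ₗᵢ[ℝ] EuclideanSpace ℝ (Fin 3)) (c : ℝ),
      ∫⁻ y : EuclideanSpace ℝ (Fin 2), ‖u t (R (toLp 2 ![y 0, y 1, c]))‖ₑ ^ 2 ≤ ENNReal.ofReal M :=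
  planarCeiling_of_hasSmoothExtensionPast hν hT hcl hLH hdec
    (hasSmoothExtensionPast_of_bounded_holds hν hT hcl hLH hbdd)

/-- **The crux in the ESS class, registered closed form** (sub-goal
`planarCeiling_of_eLpNorm_three_bounded_closedForm` of stmt-NavierStokesRegularity-16855). [folklore] -/
theorem planarCeiling_of_eLpNorm_three_bounded_closedForm : ∀ (ν T : ℝ), 0 < ν → 0 < T → ∀ (u : ℝ → EuclideanSpace ℝ (Fin 3) → EuclideanSpace ℝ (Fin 3)) (p : ℝ → EuclideanSpace ℝ (Fin 3) → ℝ), Literature.Analysis.FluidPDE.IsClassicalNSSolutionOn (Set.Ico 0 T) ν 0 u p → Literature.Analysis.FluidPDE.IsLerayHopfOn T ν 0 (u 0) u → Literature.Analysis.FluidPDE.HasRapidSpatialDecay (u 0) → (⨆ t ∈ Set.Ico 0 T, MeasureTheory.eLpNorm (u t) 3 MeasureTheory.volume) < ⊤ → ∃ M : ℝ, ∀ t ∈ Set.Ico 0 T, ∀ (R : EuclideanSpace ℝ (Fin 3) ≃ₗᵢ[ℝ] EuclideanSpace ℝ (Fin 3)) (c : ℝ), ∫⁻ y : EuclideanSpace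 ℝ (Fin 2), ‖u t (R (WithLp.toLp 2 ![y 0, y 1, c]))‖ₑ ^ 2 ≤ ENNReal.ofReal M :=
  fun _ _ hν hT _ _ hcl hLH hdec hL3 => planarCeiling_of_eLpNorm_three_bounded hν hT hcl hLH hdec hL3

/-- **The crux for bounded solutions, registered closed form** (sub-goal
`planarCeiling_of_velocity_bounded_closedForm` of stmt-NavierStokesRegularity-16855). [folklore] -/
theorem planarCeiling_of_velocity_bounded_closedForm : ∀ (ν T : ℝ), 0 < ν → 0 < T → ∀ (u : ℝ → EuclideanSpace ℝ (Fin 3) → EuclideanSpace ℝ (Fin 3)) (p : ℝ → EuclideanSpace ℝ (Fin 3) → ℝ), Literature.Analysis.FluidPDE.IsClassicalNSSolutionOn (Set.Ico 0 T) ν 0 u p → Literature.Analysis.FluidPDE.IsLerayHopfOn T ν 0 (u 0) u → Literature.Analysis.FluidPDE.HasRapidSpatialDecay (u 0) → (∃ M : ℝ, ∀ t ∈ Set.Ico 0 T, ∀ x, ‖u t x‖ ≤ M) → ∃ M : ℝ, ∀ t ∈ Set.Ico 0 T, ∀ (R : EuclideanSpace ℝ (Fin 3) ≃ₗᵢ[ℝ]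 EuclideanSpace ℝ (Fin 3)) (c : ℝ), ∫⁻ y : EuclideanSpace ℝ (Fin 2), ‖u t (R (WithLp.toLp 2 ![y 0, y 1, c]))‖ₑ ^ 2 ≤ ENNReal.ofReal M :=
  fun _ _ hν hT _ _ hcl hLH hdec hbdd => planarCeiling_of_velocity_bounded hν hT hcl hLH hdec hbdd

/-- **THE CRUX IN THE CRITICAL BESOV (Gallagher–Koch–Planchon) CLASS.** Along every classical
solution of unforced Navier–Stokes on `ℝ³ × [0,T)` (`ν, T > 0`) that is Leray–Hopf from a rapidly
decaying datum, whose slices are represented by tempered distributions `U t` with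
`sup_{t<T} ‖U t‖_{Ḃ^{-1+3/r}_{r,q}} < ∞` (`3 < r < ∞`, `3 < q < ∞`), the planar kinetic energies
are bounded uniformly in `t < T`, `R`, `c` (discharged
`hasSmoothExtensionPast_of_eHomBesovNorm_bounded_holds`, GKP 2016 / Wang–Zhang 2017).
(Appended 2026-08-17.) [folklore] -/
theorem planarCeiling_of_eHomBesovNorm_bounded (hν : 0 < ν) (hT : 0 < T)
    (hcl : IsClassicalNSSolutionOn (Ico 0 T) ν 0 u p) (hLH : IsLerayHopfOn T ν 0 (u 0) u)
    (hdec : HasRapidSpatialDecay (u 0))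
    (U : ℝ → TemperedDistribution (EuclideanSpace ℝ (Fin 3)) (EuclideanSpace ℂ (Fin 3)))
    {r q : ℝ≥0∞} [Fact (1 ≤ r)] (hr3 : 3 < r) (hr : r < ⊤) (hq3 : 3 < q) (hq : q < ⊤)
    (hU : ∀ t ∈ Ico 0 T, IsDistributionOf (u t) (U t))
    (hsup : (⨆ t ∈ Ico 0 T, Literature.Analysis.FunctionSpaces.eHomBesovNorm (-1 + 3 / r.toReal) r q (U t)) < ⊤) :
    ∃ M : ℝ, ∀ t ∈ Ico 0 T, ∀ (R : EuclideanSpace ℝ (Fin 3) ≃ₗᵢ[ℝ] EuclideanSpace ℝ (Fin 3)) (c : ℝ),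
      ∫⁻ y : EuclideanSpace ℝ (Fin 2), ‖u t (R (toLp 2 ![y 0, y 1, c]))‖ₑ ^ 2 ≤ ENNReal.ofReal M :=
  planarCeiling_of_hasSmoothExtensionPast hν hT hcl hLH hdec
    (hasSmoothExtensionPast_of_eHomBesovNorm_bounded_holds ν T hν hT u p U r q hr3 hr hq3 hq hcl hLH hdec hU hsup)

/-- **The crux in the critical Besov class, registered closed form** (sub-goal
`planarCeiling_of_eHomBesovNorm_bounded_closedForm` of stmt-NavierStokesRegularity-16855). [folklore] -/
theorem planarCeiling_of_eHomBesovNorm_bounded_closedForm : ∀ (ν T : ℝ), 0 < ν → 0 < T → ∀ (u : ℝ → EuclideanSpace ℝ (Fin 3) → EuclideanSpace ℝ (Fin 3)) (p : ℝ → EuclideanSpace ℝ (Fin 3) → ℝ) (U : ℝ → TemperedDistribution (EuclideanSpace ℝ (Fin 3)) (EuclideanSpace ℂ (Fin 3))) (r q : ENNReal) [Fact (1 ≤ r)], 3 < r → r < ⊤ → 3 < q → q < ⊤ → Literature.Analysis.FluidPDE.IsClassicalNSSolutionOn (Set.Ico 0 T) ν 0 u p → Literature.Analysis.FluidPDE.IsLerayHopfOn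 T ν 0 (u 0) u → Literature.Analysis.FluidPDE.HasRapidSpatialDecay (u 0) → (∀ t ∈ Set.Ico 0 T, Literature.Analysis.FluidPDE.IsDistributionOf (u t) (U t)) → (⨆ t ∈ Set.Ico 0 T, Literature.Analysis.FunctionSpaces.eHomBesovNorm (-1 + 3 / r.toReal) r q (U t)) < ⊤ → ∃ M : ℝ, ∀ t ∈ Set.Ico 0 T, ∀ (R : EuclideanSpace ℝ (Fin 3) ≃ₗᵢ[ℝ] EuclideanSpace ℝ (Fin 3)) (c : ℝ), ∫⁻ y : EuclideanSpace ℝ (Fin 2), ‖u t (R (WithLp.toLp 2 ![y 0, y 1, c]))‖ₑ ^ 2 ≤ ENNReal.ofReal M :=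
  fun _ _ hν hT _ _ U _ _ _ hr3 hr hq3 hq hcl hLH hdec hU hsup =>
    planarCeiling_of_eHomBesovNorm_bounded hν hT hcl hLH hdec U hr3 hr hq3 hq hU hsup

end Summit.NavierStokesRegularity.NavierStokesRegularity.Theorems.PlanarEnergyAPriori

end
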